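import Summits.AtomisticToContinuum.HydrodynamicLimit.Theorems.LambertianContactSwapLambertianEulerExpectedWindowProduction
import Summits.AtomisticToContinuum.HydrodynamicLimit.Theorems.LambertianContactSwapLambertianEulerDockRf
import Literature.MathematicalPhysics.KineticTheory.LambertianRedrawNondegenerate
import Literature.MathematicalPhysics.KineticTheory.HardSphereEulerLLN
import Literature.Analysis.FluidPDE.HardSphereAlexander
import HarnessLib

/-!
# The two research hearts of the Lambertian Euler limit, and the clock's intermediate statements (line `Sketch`, crux stmt-11854)

Support file (`--supports stmt-AtomisticToContinuum-11854`) of the line `Sketch` of the crux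
`Summit.AtomisticToContinuum.HydrodynamicLimit.Theses.LambertianContactSwap.LambertianEuler` (= `…LindebergRandomFuture.LambertianEuler`,
same term): Euler (compressible hs-Euler, pre-shock) as the hydrodynamic limit of the LAMBERTIAN hard-sphere gas `Λ` (free flight +
Alexander exit times + cosine redraw of the colliding pair's relative velocity) from local Gibbs data.  Six line leads (c0–c5) drove the
registered skeleton `Cruxes/LambertianEuler/Lines/Sketch.lean` to exactly three open leaves; this file NAMES them and the intermediate
statements of Yau's relative-entropy clock for `Λ`, so that the kernel-checked reduction can live in the tree
(`…LambertianEulerEstimateOfHearts`, `…LambertianEulerOfHearts`) instead of a 180 KB workfile: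

* §1 the windowed functionals of the line along `Λ` under `λ_N ⊗ γ^ℕ` (`Hent` = relative entropy of the law of `Λ_{r′}` w.r.t. the
  explicit reference `localGibbsLaw σ (ρ_{r′}Rf(σ³ρ_{r′})) u_{r′} θ_{r′}`; `Yint` = fast kinetic current; `Xint` = collisional
  counter-terms; `Sint` = streaming term of the FORMULA p128635; `Jmp` = cosine-compensated collision jumps; `dLZ` = statics);
* §2 the two RESEARCH HEARTS as named Props — P3Λ `KineticOneBlockInMeanLambda` and P4Λ `CollisionalOneBlockInMeanLambda` (the
  local ergodic theorem of the Lambertian gas split into its kinetic and collisional halves, typed ONE-SIDED, FIRST-MOMENT, on arbitrary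
  sub-intervals with entropy allowance `C (s′−s) M`; `_iff` lemmas certify by `Iff.rfl` that they ARE the registered stub signatures
  `stub_kineticOneBlockInMeanLambda` / `stub_collisionalOneBlockInMeanLambda` of stmt-11854) — and the clock's intermediate statements
  `WindowProductionEstimateLambda` (ESTIMATE), `WindowProductionBoundLambda` (BOUND), `WindowStepLambda` (STEP), `GronwallRfLambda`
  (the first hypothesis of the landed Rf-dock p120849 without its dilute-self-consistency premise).

Lead prover-line-stmt-AtomisticToContinuum-11854-c6-0 (cycle 1), 2026-08-17.  [cite: Yau1991, §2] [cite: OllaVaradhanYau1993, §3–§4]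
-/

noncomputable section

namespace Summit.AtomisticToContinuum.HydrodynamicLimit.Theorems.LambertianContactSwapLambertianEulerHearts

open scoped BigOperators Topology ENNReal InnerProductSpace
open MeasureTheory ProbabilityTheory Filter Set InformationTheory
open Literature.MathematicalPhysics.KineticTheory
open Literature.Analysis.FluidPDE Literature.Analysis.FluidPDE.Alexander
open Summit.AtomisticToContinuum.HydrodynamicLimit.Theorems.ClampedCurrentsDockPathwise (gSum DgSum)

/-! ## §1 The functionals (abbreviations of the line) -/

/-- `H_N(r′)`: relative entropy (real-valued) of the law of `Λ_{r′}` under `λ_N ⊗ γ^ℕ` with respect to the explicit reference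
`localGibbsLaw σ (ρ_{r′}·Rf(σ³ρ_{r′})) u_{r′} θ_{r′}` (local abbreviation of the line; registered signatures expand it). -/
def Hent (σ : ℝ) (a₀ θ₀ : T3 → ℝ) (u₀ : T3 → V3) (Rf : ℝ → ℝ) (ρ θ : ℝ → T3 → ℝ) (u : ℝ → T3 → V3)
    (N : ℕ) (Φ : HardSphereFlow (Torus.geometry (Fin 3)) (hsDiameter σ N) (N + 1)) (r' : ℝ) : ℝ :=
  (klDiv (((localGibbsLaw σ a₀ u₀ θ₀ N Φ).prod (lambertNoise (Fin 3))).map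
        (fun p => lambertFlow (Torus.geometry (Fin 3)) (hsDiameter σ N) p.2 p.1 r'))
      (localGibbsLaw σ (fun x => ρ r' x * Rf (σ ^ 3 * ρ r' x)) (u r') (θ r') N Φ)).toReal

/-- `E_λ[∫_s^{s′} Σ_i Y⊥_r((Λ_r)_i) dr]`: the windowed FAST KINETIC CURRENT functional along `Λ` (local abbreviation). -/
def Yint (σ : ℝ) (a₀ θ₀ : T3 → ℝ) (u₀ : T3 → V3) (θ : ℝ → T3 → ℝ) (u : ℝ → T3 → V3)
    (N : ℕ) (Φ : HardSphereFlow (Torus.geometry (Fin 3)) (hsDiameter σ N) (N + 1)) (s s' : ℝ) : ℝ :=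
  ∫ p, (∫ r in s..s', ∑ i : Fin (N + 1), ((θ r (lambertFlow (Torus.geometry (Fin 3)) (hsDiameter σ N) p.2 p.1 r i).1)⁻¹ * ∑ j : Fin 3, ∑ k : Fin 3, (((lambertFlow (Torus.geometry (Fin 3)) (hsDiameter σ N) p.2 p.1 r i).2 - u r (lambertFlow (Torus.geometry (Fin 3)) (hsDiameter σ N) p.2 p.1 r i).1) j * ((lambertFlow (Torus.geometry (Fin 3)) (hsDiameter σ N) p.2 p.1 r i).2 - u r (lambertFlow (Torus.geometry (Fin 3)) (hsDiameter σ N) p.2 p.1 r i).1) k - (if j = k then ‖(lambertFlow (Torus.geometry (Fin 3)) (hsDiameter σ N) p.2 p.1 r i).2 - u r (lambertFlow (Torus.geometry (Fin 3)) (hsDiameter σ N) p.2 p.1 r i).1‖ ^ 2 / 3 else 0)) * Literature.Analysis.FunctionSpaces.Torus.partialDeriv k (fun y => u r y j) (lambertFlow (Torus.geometry (Fin 3)) (hsDiameter σ N) p.2 p.1 r i).1 + (‖(lambertFlow (Torus.geometry (Fin 3)) (hsDiameter σ N) p.2 p.1 r i).2 - u r (lambertFlow (Torus.geometry (Fin 3))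 (hsDiameter σ N) p.2 p.1 r i).1‖ ^ 2 - 5 * θ r (lambertFlow (Torus.geometry (Fin 3)) (hsDiameter σ N) p.2 p.1 r i).1) * (∑ k : Fin 3, ((lambertFlow (Torus.geometry (Fin 3)) (hsDiameter σ N) p.2 p.1 r i).2 - u r (lambertFlow (Torus.geometry (Fin 3)) (hsDiameter σ N) p.2 p.1 r i).1) k * Literature.Analysis.FunctionSpaces.Torus.partialDeriv k (θ r) (lambertFlow (Torus.geometry (Fin 3)) (hsDiameter σ N) p.2 p.1 r i).1) / (2 * (θ r (lambertFlow (Torus.geometry (Fin 3)) (hsDiameter σ N) p.2 p.1 r i).1) ^ 2))) ∂((localGibbsLaw σ a₀ u₀ θ₀ N Φ).prod (lambertNoise (Fin 3)))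

/-- `E_λ[∫_s^{s′} Σ_i X_r((Λ_r)_i) dr]`: the windowed COLLISIONAL COUNTER-TERM functional along `Λ` (local abbreviation). -/
def Xint (σ : ℝ) (a₀ θ₀ : T3 → ℝ) (u₀ : T3 → V3) (ρ θ : ℝ → T3 → ℝ) (u : ℝ → T3 → V3)
    (N : ℕ) (Φ : HardSphereFlow (Torus.geometry (Fin 3)) (hsDiameter σ N) (N + 1)) (s s' : ℝ) : ℝ :=
  ∫ p, (∫ r in s..s', ∑ i : Fin (N + 1), ((∑ k : Fin 3, Literature.Analysis.FunctionSpaces.Torus.partialDeriv k (fun y => u r y k / θ r y) (lambertFlow (Torus.geometry (Fin 3)) (hsDiameter σ N) p.2 p.1 r i).1) * (θ r (lambertFlow (Torus.geometry (Fin 3)) (hsDiameter σ N) p.2 p.1 r i).1 * (ρ r (lambertFlow (Torus.geometry (Fin 3)) (hsDiameter σ N) p.2 p.1 r i).1 * σ ^ 3) * deriv hsCompressibility (ρ r (lambertFlow (Torus.geometry (Fin 3)) (hsDiameter σ N) p.2 p.1 r i).1 * σ ^ 3) + (1 / 3) * (hsCompressibility (ρ r (lambertFlow (Torus.geometry (Fin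 3)) (hsDiameter σ N) p.2 p.1 r i).1 * σ ^ 3) - 1) * ‖(lambertFlow (Torus.geometry (Fin 3)) (hsDiameter σ N) p.2 p.1 r i).2 - u r (lambertFlow (Torus.geometry (Fin 3)) (hsDiameter σ N) p.2 p.1 r i).1‖ ^ 2) + ((∑ k : Fin 3, u r (lambertFlow (Torus.geometry (Fin 3)) (hsDiameter σ N) p.2 p.1 r i).1 k * Literature.Analysis.FunctionSpaces.Torus.partialDeriv k (θ r) (lambertFlow (Torus.geometry (Fin 3)) (hsDiameter σ N) p.2 p.1 r i).1) / (θ r (lambertFlow (Torus.geometry (Fin 3)) (hsDiameter σ N) p.2 p.1 r i).1) ^ 2) * (θ r (lambertFlow (Torus.geometry (Fin 3)) (hsDiameter σ N) p.2 p.1 r i).1 * (ρ r (lambertFlow (Torus.geometry (Fin 3)) (hsDiameter σ N) p.2 p.1 r i).1 * σ ^ 3) * deriv hsCompressibility (ρ r (lambertFlow (Torus.geometry (Fin 3)) (hsDiameter σ N) p.2 p.1 r i).1 * σ ^ 3) + (1 / 3) * (hsCompressibility (ρ r (lambertFlow (Torus.geometry (Fin 3)) (hsDiameter σ N) p.2 p.1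 r i).1 * σ ^ 3) - 1) * ‖(lambertFlow (Torus.geometry (Fin 3)) (hsDiameter σ N) p.2 p.1 r i).2 - u r (lambertFlow (Torus.geometry (Fin 3)) (hsDiameter σ N) p.2 p.1 r i).1‖ ^ 2) + (hsCompressibility (ρ r (lambertFlow (Torus.geometry (Fin 3)) (hsDiameter σ N) p.2 p.1 r i).1 * σ ^ 3) - 1) * (∑ k : Fin 3, ((lambertFlow (Torus.geometry (Fin 3)) (hsDiameter σ N) p.2 p.1 r i).2 - u r (lambertFlow (Torus.geometry (Fin 3)) (hsDiameter σ N) p.2 p.1 r i).1) k * Literature.Analysis.FunctionSpaces.Torus.partialDeriv k (θ r) (lambertFlow (Torus.geometry (Fin 3)) (hsDiameter σ N) p.2 p.1 r i).1) / θ r (lambertFlow (Torus.geometry (Fin 3)) (hsDiameter σ N) p.2 p.1 r i).1)) ∂((localGibbsLaw σ a₀ u₀ θ₀ N Φ).prod (lambertNoise (Fin 3)))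

/-- `E_λ[∫_s^{s′} Σ_i Dg_r(Λ_r) dr]`: the windowed STREAMING functional of the FORMULA along `a = ρ·Rf(σ³ρ)` (local abbreviation). -/
def Sint (σ : ℝ) (a₀ θ₀ : T3 → ℝ) (u₀ : T3 → V3) (Rf : ℝ → ℝ) (ρ θ : ℝ → T3 → ℝ) (u : ℝ → T3 → V3) (T : ℝ)
    (N : ℕ) (Φ : HardSphereFlow (Torus.geometry (Fin 3)) (hsDiameter σ N) (N + 1)) (s s' : ℝ) : ℝ :=
  ∫ p, (∫ r in s..s', DgSum T (fun r x => ρ r x * Rf (σ ^ 3 * ρ r x)) θ u r (lambertFlow (Torus.geometry (Fin 3)) (hsDiameter σ N) p.2 p.1 r)) ∂((localGibbsLaw σ a₀ u₀ θ₀ N Φ).prod (lambertNoise (Fin 3)))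

/-- `E_λ[Σ_{m<K_{s′}, s<t_{m+1}} (compensated jump of Σ_i g at z_m♭)]`: the windowed COLLISION functional of the FORMULA
(local abbreviation). -/
def Jmp (σ : ℝ) (a₀ θ₀ : T3 → ℝ) (u₀ : T3 → V3) (Rf : ℝ → ℝ) (ρ θ : ℝ → T3 → ℝ) (u : ℝ → T3 → V3)
    (N : ℕ) (Φ : HardSphereFlow (Torus.geometry (Fin 3)) (hsDiameter σ N) (N + 1)) (s s' : ℝ) : ℝ :=
  ∫ p, (∑ m ∈ Finset.range (lambertCount (Torus.geometry (Fin 3)) (hsDiameter σ N) p.2 p.1 s'),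
        if s < (lambertInstant (Torus.geometry (Fin 3)) (hsDiameter σ N) p.2 p.1 (m + 1)).toReal then
          (∫ ξ, gSum (fun r x => ρ r x * Rf (σ ^ 3 * ρ r x)) θ u (lambertInstant (Torus.geometry (Fin 3)) (hsDiameter σ N) p.2 p.1 (m + 1)).toReal
              (lambertStepMap (Torus.geometry (Fin 3)) (incomingPairs (Torus.geometry (Fin 3)) (hsDiameter σ N)
                (freeFlight (Torus.geometry (Fin 3)) (freeExitTime (Torus.geometry (Fin 3)) (hsDiameter σ N) (lambertStateAfter (Torus.geometry (Fin 3)) (hsDiameter σ N) p.2 p.1 m)).toReal (lambertStateAfter (Torus.geometry (Fin 3)) (hsDiameter σ N) p.2 p.1 m)))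
                (freeFlight (Torus.geometry (Fin 3)) (freeExitTime (Torus.geometry (Fin 3)) (hsDiameter σ N) (lambertStateAfter (Torus.geometry (Fin 3)) (hsDiameter σ N) p.2 p.1 m)).toReal (lambertStateAfter (Torus.geometry (Fin 3)) (hsDiameter σ N) p.2 p.1 m)) ξ) ∂(stdGaussian V3)) -
            gSum (fun r x => ρ r x * Rf (σ ^ 3 * ρ r x)) θ u (lambertInstant (Torus.geometry (Fin 3)) (hsDiameter σ N) p.2 p.1 (m + 1)).toReal
              (freeFlight (Torus.geometry (Fin 3)) (freeExitTime (Torus.geometry (Fin 3)) (hsDiameter σ N) (lambertStateAfter (Torus.geometry (Fin 3)) (hsDiameter σ N) p.2 p.1 m)).toReal (lambertStateAfter (Torus.geometry (Fin 3)) (hsDiameter σ N) p.2 p.1 m))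
        else 0) ∂((localGibbsLaw σ a₀ u₀ θ₀ N Φ).prod (lambertNoise (Fin 3)))

/-- `log Zpos(a_{s′}) − log Zpos(a_s)`: the statics of the FORMULA (local abbreviation). -/
def dLZ (σ : ℝ) (Rf : ℝ → ℝ) (ρ : ℝ → T3 → ℝ) (N : ℕ) (s s' : ℝ) : ℝ :=
  Real.log (posPartition (fun x => ρ s' x * Rf (σ ^ 3 * ρ s' x)) (hsDiameter σ N) (N + 1)) -
        Real.log (posPartition (fun x => ρ s x * Rf (σ ^ 3 * ρ s x)) (hsDiameter σ N) (N + 1))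

/-! ## §2 The two research hearts and the intermediate statements of the clock, as named Props -/

/-- **P3Λ — THE KINETIC HEART** (research; registered stub `stub_kineticOneBlockInMeanLambda` of crux stmt-11854, line `Sketch`; lead c5's typing, v30). **Mean fast kinetic current along the Lambertian flow, with entropy allowance**: in the frame (insertion factor `Rf`; a band `ηh > 0` of the prover's choosing; continuous positive data profiles; `σ < σ₀`; a classical hs-Euler solution on `[0,T)` with packing `< ηh`; a flow family fixing the phase spaces; the `t = 0` tie; `t ∈ (0,T)`) there is `C ≥ 0` such that for every `ε > 0`, eventually in `N`, for ALL `0 ≤ s ≤ s′ ≤ t` and every bound `M` of `H_N` on `[s,s′]`: `−E_{λ_N ⊗ γ^ℕ}[∫_s^{s′} Σ_i Y⊥_r(x_i(r), v_i(r)) dr] ≤ C (s′−s) M + ε (N+1)`, `Y⊥ =` traceless peculiar stress against `∇u/θ` + kinetic heat current `(|c|²−5θ)c·∇θ/(2θ²)`. ONE-SIDED, FIRST-MOMENT (no exponential moment, window, cut-off or clamp: the cubic heat current is in `L¹`). The kinetic half of the local ergodic theorem of `Λ` (Olla–Varadhan–Yau 1993 §3–4 class, noise only at contacts; OPEN — a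 research statement of this line, not a published fact). -/
def KineticOneBlockInMeanLambda : Prop :=
  ∀ (r : ℝ) (Rf : ℝ → ℝ), 0 < r →
      (∀ x ∈ Set.Ioo (-r) r, 0 < Rf x ∧ Rf x * (∑' j : ℕ, bE j / (j.factorial : ℝ) * (x * Rf x) ^ j) = 1) →
      (∀ x ∈ Set.Icc 0 r, 1 ≤ Rf x ∧ Rf x ≤ 2) → ContinuousOn Rf (Set.Icc 0 r) →
      (∀ x ∈ Set.Ioo (-r) r, ∀ R ∈ Set.Icc (1 / 2 : ℝ) 2,
        R * (∑' j : ℕ, bE j / (j.factorial : ℝ) * (x * R) ^ j) = 1 → R = Rf x) →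
    ∃ ηh : ℝ, 0 < ηh ∧ ∀ (a₀ θ₀ : T3 → ℝ) (u₀ : T3 → V3), Continuous a₀ → Continuous θ₀ → Continuous u₀ →
      (∀ x, 0 < a₀ x) → (∀ x, 0 < θ₀ x) →
      ∃ σ₀ : ℝ, 0 < σ₀ ∧ ∀ σ : ℝ, 0 < σ → σ < σ₀ →
        ∀ (T : ℝ) (ρ θ : ℝ → T3 → ℝ) (u : ℝ → T3 → V3), IsHardSphereEulerSolution σ T ρ u θ →
          (∀ t ∈ Set.Ico 0 T, ∀ x, ρ t x * σ ^ 3 < ηh) →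
          ∀ Φ : (N : ℕ) → HardSphereFlow (Torus.geometry (Fin 3)) (hsDiameter σ N) (N + 1),
            TendstoHydroFieldsAt (fun N => localGibbsLaw σ a₀ u₀ θ₀ N (Φ N)) Φ ρ u θ 0 →
            ∀ t ∈ Set.Ioo 0 T, ∃ C : ℝ, 0 ≤ C ∧ ∀ ε : ℝ, 0 < ε → ∃ N₀ : ℕ, ∀ N : ℕ, N₀ ≤ N →
              ∀ (s s' M : ℝ), 0 ≤ s → s ≤ s' → s' ≤ t →
                (∀ r' ∈ Set.Icc s s', Hent σ a₀ θ₀ u₀ Rf ρ θ u N (Φ N) r' ≤ M) →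
                -(Yint σ a₀ θ₀ u₀ θ u N (Φ N) s s') ≤ C * (s' - s) * M + ε * ((N : ℝ) + 1)

/-- **P4Λ — THE COLLISIONAL HEART** (research; registered stub `stub_collisionalOneBlockInMeanLambda` of crux stmt-11854, line `Sketch`; lead c5's typing, v30). **Mean cosine-compensated collisional transfer of the reference observable along `Λ`, minus its exact one-body linear response and statics, with entropy allowance**: same frame as P3Λ; `−E_λ[Σ_contacts compensated jump of Σ_i g] + E_λ[∫_s^{s′} Σ_i X_r dr] + (log Zpos(a_{s′}) − log Zpos(a_s)) ≤ C (s′−s) M + ε (N+1)`, `X =` momentum / temperature / density response of the excess pressure `ρθ(Z−1)`; the compensated jump has the closed form p124484 (mean momentum transfer `(2/3)|g|` = the hs equation of state). Under the reference the three terms cancel at finite `N`; the statement is that along `Λ` they cancel up to `C·H + o(N)` — the collisional half of the local ergodic theorem (OPEN — a research statement of this line, not a published fact). -/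
def CollisionalOneBlockInMeanLambda : Prop :=
  ∀ (r : ℝ) (Rf : ℝ → ℝ), 0 < r →
      (∀ x ∈ Set.Ioo (-r) r, 0 < Rf x ∧ Rf x * (∑' j : ℕ, bE j / (j.factorial : ℝ) * (x * Rf x) ^ j) = 1) →
      (∀ x ∈ Set.Icc 0 r, 1 ≤ Rf x ∧ Rf x ≤ 2) → ContinuousOn Rf (Set.Icc 0 r) →
      (∀ x ∈ Set.Ioo (-r) r, ∀ R ∈ Set.Icc (1 / 2 : ℝ) 2,
        R * (∑' j : ℕ, bE j / (j.factorial : ℝ) * (x * R) ^ j) = 1 → R = Rf x) →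
    ∃ ηh : ℝ, 0 < ηh ∧ ∀ (a₀ θ₀ : T3 → ℝ) (u₀ : T3 → V3), Continuous a₀ → Continuous θ₀ → Continuous u₀ →
      (∀ x, 0 < a₀ x) → (∀ x, 0 < θ₀ x) →
      ∃ σ₀ : ℝ, 0 < σ₀ ∧ ∀ σ : ℝ, 0 < σ → σ < σ₀ →
        ∀ (T : ℝ) (ρ θ : ℝ → T3 → ℝ) (u : ℝ → T3 → V3), IsHardSphereEulerSolution σ T ρ u θ →
          (∀ t ∈ Set.Ico 0 T, ∀ x, ρ t x * σ ^ 3 < ηh) →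
          ∀ Φ : (N : ℕ) → HardSphereFlow (Torus.geometry (Fin 3)) (hsDiameter σ N) (N + 1),
            TendstoHydroFieldsAt (fun N => localGibbsLaw σ a₀ u₀ θ₀ N (Φ N)) Φ ρ u θ 0 →
            ∀ t ∈ Set.Ioo 0 T, ∃ C : ℝ, 0 ≤ C ∧ ∀ ε : ℝ, 0 < ε → ∃ N₀ : ℕ, ∀ N : ℕ, N₀ ≤ N →
              ∀ (s s' M : ℝ), 0 ≤ s → s ≤ s' → s' ≤ t →
                (∀ r' ∈ Set.Icc s s', Hent σ a₀ θ₀ u₀ Rf ρ θ u N (Φ N) r' ≤ M) →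
                -(Jmp σ a₀ θ₀ u₀ Rf ρ θ u N (Φ N) s s') + Xint σ a₀ θ₀ u₀ ρ θ u N (Φ N) s s' +
                    dLZ σ Rf ρ N s s' ≤ C * (s' - s) * M + ε * ((N : ℝ) + 1)

/-- The named kinetic heart IS the registered expanded stub signature `stub_kineticOneBlockInMeanLambda` (definitional unfolding of `Hent`, `Yint`). -/
theorem kineticOneBlockInMeanLambda_iff :
    KineticOneBlockInMeanLambda ↔
    (    ∀ (r : ℝ) (Rf : ℝ → ℝ), 0 < r →
      (∀ x ∈ Set.Ioo (-r) r, 0 < Rf x ∧ Rf x * (∑' j : ℕ, bE j / (j.factorial : ℝ) * (x * Rf x) ^ j) = 1) →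
      (∀ x ∈ Set.Icc 0 r, 1 ≤ Rf x ∧ Rf x ≤ 2) → ContinuousOn Rf (Set.Icc 0 r) →
      (∀ x ∈ Set.Ioo (-r) r, ∀ R ∈ Set.Icc (1 / 2 : ℝ) 2,
        R * (∑' j : ℕ, bE j / (j.factorial : ℝ) * (x * R) ^ j) = 1 → R = Rf x) →
    ∃ ηh : ℝ, 0 < ηh ∧ ∀ (a₀ θ₀ : T3 → ℝ) (u₀ : T3 → V3), Continuous a₀ → Continuous θ₀ → Continuous u₀ →
      (∀ x, 0 < a₀ x) → (∀ x, 0 < θ₀ x) →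
      ∃ σ₀ : ℝ, 0 < σ₀ ∧ ∀ σ : ℝ, 0 < σ → σ < σ₀ →
        ∀ (T : ℝ) (ρ θ : ℝ → T3 → ℝ) (u : ℝ → T3 → V3), IsHardSphereEulerSolution σ T ρ u θ →
          (∀ t ∈ Set.Ico 0 T, ∀ x, ρ t x * σ ^ 3 < ηh) →
          ∀ Φ : (N : ℕ) → HardSphereFlow (Torus.geometry (Fin 3)) (hsDiameter σ N) (N + 1),
            TendstoHydroFieldsAt (fun N => localGibbsLaw σ a₀ u₀ θ₀ N (Φ N)) Φ ρ u θ 0 →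
            ∀ t ∈ Set.Ioo 0 T, ∃ C : ℝ, 0 ≤ C ∧ ∀ ε : ℝ, 0 < ε → ∃ N₀ : ℕ, ∀ N : ℕ, N₀ ≤ N →
              ∀ (s s' M : ℝ), 0 ≤ s → s ≤ s' → s' ≤ t →
                (∀ r' ∈ Set.Icc s s',
                  (klDiv (((localGibbsLaw σ a₀ u₀ θ₀ N (Φ N)).prod (lambertNoise (Fin 3))).map
        (fun p => lambertFlow (Torus.geometry (Fin 3)) (hsDiameter σ N) p.2 p.1 r'))
      (localGibbsLaw σ (fun x => ρ r' x * Rf (σ ^ 3 * ρ r' x)) (u r') (θ r') N (Φ N))).toReal ≤ M) →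
                -(∫ p, (∫ r in s..s', ∑ i : Fin (N + 1), ((θ r (lambertFlow (Torus.geometry (Fin 3)) (hsDiameter σ N) p.2 p.1 r i).1)⁻¹ * ∑ j : Fin 3, ∑ k : Fin 3, (((lambertFlow (Torus.geometry (Fin 3)) (hsDiameter σ N) p.2 p.1 r i).2 - u r (lambertFlow (Torus.geometry (Fin 3)) (hsDiameter σ N) p.2 p.1 r i).1) j * ((lambertFlow (Torus.geometry (Fin 3)) (hsDiameter σ N) p.2 p.1 r i).2 - u r (lambertFlow (Torus.geometry (Fin 3)) (hsDiameter σ N) p.2 p.1 r i).1) k - (if j = k then ‖(lambertFlow (Torus.geometry (Fin 3)) (hsDiameter σ N) p.2 p.1 r i).2 - u r (lambertFlow (Torus.geometry (Fin 3)) (hsDiameter σ N) p.2 p.1 r i).1‖ ^ 2 / 3 else 0)) * Literature.Analysis.FunctionSpaces.Torus.partialDeriv k (fun y => u r y j) (lambertFlow (Torus.geometry (Fin 3)) (hsDiameter σ N) p.2 p.1 r i).1 + (‖(lambertFlow (Torus.geometry (Fin 3)) (hsDiameter σ N) p.2 p.1 r i).2 - u r (lambertFlow (Torus.geometry (Fin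 3)) (hsDiameter σ N) p.2 p.1 r i).1‖ ^ 2 - 5 * θ r (lambertFlow (Torus.geometry (Fin 3)) (hsDiameter σ N) p.2 p.1 r i).1) * (∑ k : Fin 3, ((lambertFlow (Torus.geometry (Fin 3)) (hsDiameter σ N) p.2 p.1 r i).2 - u r (lambertFlow (Torus.geometry (Fin 3)) (hsDiameter σ N) p.2 p.1 r i).1) k * Literature.Analysis.FunctionSpaces.Torus.partialDeriv k (θ r) (lambertFlow (Torus.geometry (Fin 3)) (hsDiameter σ N) p.2 p.1 r i).1) / (2 * (θ r (lambertFlow (Torus.geometry (Fin 3)) (hsDiameter σ N) p.2 p.1 r i).1) ^ 2))) ∂((localGibbsLaw σ a₀ u₀ θ₀ N (Φ N)).prod (lambertNoise (Fin 3)))) ≤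
                  C * (s' - s) * M + ε * ((N : ℝ) + 1)) :=
  Iff.rfl

/-- The named collisional heart IS the registered expanded stub signature `stub_collisionalOneBlockInMeanLambda` (definitional unfolding of `Hent`, `Jmp`, `Xint`, `dLZ`). -/
theorem collisionalOneBlockInMeanLambda_iff :
    CollisionalOneBlockInMeanLambda ↔
    (    ∀ (r : ℝ) (Rf : ℝ → ℝ), 0 < r →
      (∀ x ∈ Set.Ioo (-r) r, 0 < Rf x ∧ Rf x * (∑' j : ℕ, bE j / (j.factorial : ℝ) * (x * Rf x) ^ j) = 1) →
      (∀ x ∈ Set.Icc 0 r, 1 ≤ Rf x ∧ Rf x ≤ 2) → ContinuousOn Rf (Set.Icc 0 r) →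
      (∀ x ∈ Set.Ioo (-r) r, ∀ R ∈ Set.Icc (1 / 2 : ℝ) 2,
        R * (∑' j : ℕ, bE j / (j.factorial : ℝ) * (x * R) ^ j) = 1 → R = Rf x) →
    ∃ ηh : ℝ, 0 < ηh ∧ ∀ (a₀ θ₀ : T3 → ℝ) (u₀ : T3 → V3), Continuous a₀ → Continuous θ₀ → Continuous u₀ →
      (∀ x, 0 < a₀ x) → (∀ x, 0 < θ₀ x) →
      ∃ σ₀ : ℝ, 0 < σ₀ ∧ ∀ σ : ℝ, 0 < σ → σ < σ₀ →
        ∀ (T : ℝ) (ρ θ : ℝ → T3 → ℝ) (u : ℝ → T3 → V3), IsHardSphereEulerSolution σ T ρ u θ →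
          (∀ t ∈ Set.Ico 0 T, ∀ x, ρ t x * σ ^ 3 < ηh) →
          ∀ Φ : (N : ℕ) → HardSphereFlow (Torus.geometry (Fin 3)) (hsDiameter σ N) (N + 1),
            TendstoHydroFieldsAt (fun N => localGibbsLaw σ a₀ u₀ θ₀ N (Φ N)) Φ ρ u θ 0 →
            ∀ t ∈ Set.Ioo 0 T, ∃ C : ℝ, 0 ≤ C ∧ ∀ ε : ℝ, 0 < ε → ∃ N₀ : ℕ, ∀ N : ℕ, N₀ ≤ N →
              ∀ (s s' M : ℝ), 0 ≤ s → s ≤ s' → s' ≤ t →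
                (∀ r' ∈ Set.Icc s s',
                  (klDiv (((localGibbsLaw σ a₀ u₀ θ₀ N (Φ N)).prod (lambertNoise (Fin 3))).map
        (fun p => lambertFlow (Torus.geometry (Fin 3)) (hsDiameter σ N) p.2 p.1 r'))
      (localGibbsLaw σ (fun x => ρ r' x * Rf (σ ^ 3 * ρ r' x)) (u r') (θ r') N (Φ N))).toReal ≤ M) →
                -(∫ p, (∑ m ∈ Finset.range (lambertCount (Torus.geometry (Fin 3)) (hsDiameter σ N) p.2 p.1 s'),
        if s < (lambertInstant (Torus.geometry (Fin 3)) (hsDiameter σ N) p.2 p.1 (m + 1)).toReal then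
          (∫ ξ, gSum (fun r x => ρ r x * Rf (σ ^ 3 * ρ r x)) θ u (lambertInstant (Torus.geometry (Fin 3)) (hsDiameter σ N) p.2 p.1 (m + 1)).toReal
              (lambertStepMap (Torus.geometry (Fin 3)) (incomingPairs (Torus.geometry (Fin 3)) (hsDiameter σ N)
                (freeFlight (Torus.geometry (Fin 3)) (freeExitTime (Torus.geometry (Fin 3)) (hsDiameter σ N) (lambertStateAfter (Torus.geometry (Fin 3)) (hsDiameter σ N) p.2 p.1 m)).toReal (lambertStateAfter (Torus.geometry (Fin 3)) (hsDiameter σ N) p.2 p.1 m)))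
                (freeFlight (Torus.geometry (Fin 3)) (freeExitTime (Torus.geometry (Fin 3)) (hsDiameter σ N) (lambertStateAfter (Torus.geometry (Fin 3)) (hsDiameter σ N) p.2 p.1 m)).toReal (lambertStateAfter (Torus.geometry (Fin 3)) (hsDiameter σ N) p.2 p.1 m)) ξ) ∂(stdGaussian V3)) -
            gSum (fun r x => ρ r x * Rf (σ ^ 3 * ρ r x)) θ u (lambertInstant (Torus.geometry (Fin 3)) (hsDiameter σ N) p.2 p.1 (m + 1)).toReal
              (freeFlight (Torus.geometry (Fin 3)) (freeExitTime (Torus.geometry (Fin 3)) (hsDiameter σ N) (lambertStateAfter (Torus.geometry (Fin 3)) (hsDiameter σ N) p.2 p.1 m)).toReal (lambertStateAfter (Torus.geometry (Fin 3)) (hsDiameter σ N) p.2 p.1 m))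
        else 0) ∂((localGibbsLaw σ a₀ u₀ θ₀ N (Φ N)).prod (lambertNoise (Fin 3)))) +
                    (∫ p, (∫ r in s..s', ∑ i : Fin (N + 1), ((∑ k : Fin 3, Literature.Analysis.FunctionSpaces.Torus.partialDeriv k (fun y => u r y k / θ r y) (lambertFlow (Torus.geometry (Fin 3)) (hsDiameter σ N) p.2 p.1 r i).1) * (θ r (lambertFlow (Torus.geometry (Fin 3)) (hsDiameter σ N) p.2 p.1 r i).1 * (ρ r (lambertFlow (Torus.geometry (Fin 3)) (hsDiameter σ N) p.2 p.1 r i).1 * σ ^ 3) * deriv hsCompressibility (ρ r (lambertFlow (Torus.geometry (Fin 3)) (hsDiameter σ N) p.2 p.1 r i).1 * σ ^ 3) + (1 / 3) * (hsCompressibility (ρ r (lambertFlow (Torus.geometry (Fin 3)) (hsDiameter σ N) p.2 p.1 r i).1 * σ ^ 3) - 1) * ‖(lambertFlow (Torus.geometry (Fin 3)) (hsDiameter σ N) p.2 p.1 r i).2 - u r (lambertFlow (Torus.geometry (Fin 3)) (hsDiameter σ N) p.2 p.1 r i).1‖ ^ 2) + ((∑ k : Fin 3, u r (lambertFlow (Torus.geometry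 (Fin 3)) (hsDiameter σ N) p.2 p.1 r i).1 k * Literature.Analysis.FunctionSpaces.Torus.partialDeriv k (θ r) (lambertFlow (Torus.geometry (Fin 3)) (hsDiameter σ N) p.2 p.1 r i).1) / (θ r (lambertFlow (Torus.geometry (Fin 3)) (hsDiameter σ N) p.2 p.1 r i).1) ^ 2) * (θ r (lambertFlow (Torus.geometry (Fin 3)) (hsDiameter σ N) p.2 p.1 r i).1 * (ρ r (lambertFlow (Torus.geometry (Fin 3)) (hsDiameter σ N) p.2 p.1 r i).1 * σ ^ 3) * deriv hsCompressibility (ρ r (lambertFlow (Torus.geometry (Fin 3)) (hsDiameter σ N) p.2 p.1 r i).1 * σ ^ 3) + (1 / 3) * (hsCompressibility (ρ r (lambertFlow (Torus.geometry (Fin 3)) (hsDiameter σ N) p.2 p.1 r i).1 * σ ^ 3) - 1) * ‖(lambertFlow (Torus.geometry (Fin 3)) (hsDiameter σ N) p.2 p.1 r i).2 - u r (lambertFlow (Torus.geometry (Fin 3)) (hsDiameter σ N) p.2 p.1 r i).1‖ ^ 2) + (hsCompressibility (ρ r (lambertFlow (Torus.geometry (Fin 3)) (hsDiameter σ N) p.2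 p.1 r i).1 * σ ^ 3) - 1) * (∑ k : Fin 3, ((lambertFlow (Torus.geometry (Fin 3)) (hsDiameter σ N) p.2 p.1 r i).2 - u r (lambertFlow (Torus.geometry (Fin 3)) (hsDiameter σ N) p.2 p.1 r i).1) k * Literature.Analysis.FunctionSpaces.Torus.partialDeriv k (θ r) (lambertFlow (Torus.geometry (Fin 3)) (hsDiameter σ N) p.2 p.1 r i).1) / θ r (lambertFlow (Torus.geometry (Fin 3)) (hsDiameter σ N) p.2 p.1 r i).1)) ∂((localGibbsLaw σ a₀ u₀ θ₀ N (Φ N)).prod (lambertNoise (Fin 3)))) +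
                    (Real.log (posPartition (fun x => ρ s' x * Rf (σ ^ 3 * ρ s' x)) (hsDiameter σ N) (N + 1)) -
        Real.log (posPartition (fun x => ρ s x * Rf (σ ^ 3 * ρ s x)) (hsDiameter σ N) (N + 1))) ≤
                  C * (s' - s) * M + ε * ((N : ℝ) + 1)) :=
  Iff.rfl

/-- **ESTIMATE** — Yau's one-window production estimate for `Λ` on the explicit functional `Δ log Zpos − E_λ[∫ΣDg] − E_λ[Σ compensated jumps]` along `a_r = ρ_r·Rf(σ³ρ_r)`: `≤ A w H_N(s) + w (N+1) ε` on full windows of `[0,t]` (window length `w_N` chosen after `ε`), `≤ (N+1) ε` on the last partial window (the v26–v29 research kernel of the line; DERIVED from the hearts in `…EstimateOfHearts`; the shape is Yau's 1991 one-window estimate, §2). -/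
def WindowProductionEstimateLambda : Prop :=
  ∀ (r : ℝ) (Rf : ℝ → ℝ), 0 < r →
      (∀ x ∈ Set.Ioo (-r) r, 0 < Rf x ∧ Rf x * (∑' j : ℕ, bE j / (j.factorial : ℝ) * (x * Rf x) ^ j) = 1) →
      (∀ x ∈ Set.Icc 0 r, 1 ≤ Rf x ∧ Rf x ≤ 2) → ContinuousOn Rf (Set.Icc 0 r) →
      (∀ x ∈ Set.Ioo (-r) r, ∀ R ∈ Set.Icc (1 / 2 : ℝ) 2,
        R * (∑' j : ℕ, bE j / (j.factorial : ℝ) * (x * R) ^ j) = 1 → R = Rf x) →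
    ∀ (a₀ θ₀ : T3 → ℝ) (u₀ : T3 → V3), Continuous a₀ → Continuous θ₀ → Continuous u₀ →
      (∀ x, 0 < a₀ x) → (∀ x, 0 < θ₀ x) →
      ∃ σ₀ : ℝ, 0 < σ₀ ∧ ∀ σ : ℝ, 0 < σ → σ < σ₀ →
        ∀ (T : ℝ) (ρ θ : ℝ → T3 → ℝ) (u : ℝ → T3 → V3), IsHardSphereEulerSolution σ T ρ u θ →
          ∀ Φ : (N : ℕ) → HardSphereFlow (Torus.geometry (Fin 3)) (hsDiameter σ N) (N + 1),
            TendstoHydroFieldsAt (fun N => localGibbsLaw σ a₀ u₀ θ₀ N (Φ N)) Φ ρ u θ 0 →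
            ∀ t ∈ Set.Ioo 0 T,
              ∃ A : ℝ, 0 ≤ A ∧ ∀ ε : ℝ, 0 < ε → ∃ w : ℕ → ℝ, (∀ N, 0 < w N) ∧ ∃ N₀ : ℕ, ∀ N : ℕ, N₀ ≤ N →
                (∀ s : ℝ, 0 ≤ s → s + w N ≤ t →
                  dLZ σ Rf ρ N s (s + w N) - Sint σ a₀ θ₀ u₀ Rf ρ θ u T N (Φ N) s (s + w N) -
                      Jmp σ a₀ θ₀ u₀ Rf ρ θ u N (Φ N) s (s + w N) ≤
                    A * w N * Hent σ a₀ θ₀ u₀ Rf ρ θ u N (Φ N) s + w N * ((N : ℝ) + 1) * ε) ∧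
                (∀ s : ℝ, 0 ≤ s → s ≤ t → t ≤ s + w N →
                  dLZ σ Rf ρ N s t - Sint σ a₀ θ₀ u₀ Rf ρ θ u T N (Φ N) s t - Jmp σ a₀ θ₀ u₀ Rf ρ θ u N (Φ N) s t ≤
                    ((N : ℝ) + 1) * ε)

/-- **BOUND** — the expected entropy production `E_{μ_s ⊗ γ^ℕ}[log ρ_{ψ_s}(z) − log ρ_{ψ_{s+w}}(Λ_w(z, ξs))]` over one window along the explicit reference family obeys the same bounds (ESTIMATE through the FORMULA p128635). -/
def WindowProductionBoundLambda : Prop :=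
  ∀ (r : ℝ) (Rf : ℝ → ℝ), 0 < r →
      (∀ x ∈ Set.Ioo (-r) r, 0 < Rf x ∧ Rf x * (∑' j : ℕ, bE j / (j.factorial : ℝ) * (x * Rf x) ^ j) = 1) →
      (∀ x ∈ Set.Icc 0 r, 1 ≤ Rf x ∧ Rf x ≤ 2) → ContinuousOn Rf (Set.Icc 0 r) →
      (∀ x ∈ Set.Ioo (-r) r, ∀ R ∈ Set.Icc (1 / 2 : ℝ) 2,
        R * (∑' j : ℕ, bE j / (j.factorial : ℝ) * (x * R) ^ j) = 1 → R = Rf x) →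
    ∀ (a₀ θ₀ : T3 → ℝ) (u₀ : T3 → V3), Continuous a₀ → Continuous θ₀ → Continuous u₀ →
      (∀ x, 0 < a₀ x) → (∀ x, 0 < θ₀ x) →
      ∃ σ₀ : ℝ, 0 < σ₀ ∧ ∀ σ : ℝ, 0 < σ → σ < σ₀ →
        ∀ (T : ℝ) (ρ θ : ℝ → T3 → ℝ) (u : ℝ → T3 → V3), IsHardSphereEulerSolution σ T ρ u θ →
          ∀ Φ : (N : ℕ) → HardSphereFlow (Torus.geometry (Fin 3)) (hsDiameter σ N) (N + 1),
            TendstoHydroFieldsAt (fun N => localGibbsLaw σ a₀ u₀ θ₀ N (Φ N)) Φ ρ u θ 0 →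
            ∀ t ∈ Set.Ioo 0 T,
              ∃ A : ℝ, 0 ≤ A ∧ ∀ ε : ℝ, 0 < ε → ∃ w : ℕ → ℝ, (∀ N, 0 < w N) ∧ ∃ N₀ : ℕ, ∀ N : ℕ, N₀ ≤ N →
                (∀ s : ℝ, 0 ≤ s → s + w N ≤ t →
                  ∫ q, (Real.log (canonicalDensity (Torus.geometry (Fin 3)) (hsDiameter σ N) (N + 1)
                    (localGibbsProfile (fun x => ρ s x * Rf (σ ^ 3 * ρ s x)) (u s) (θ s)) q.1) -
                      Real.log (canonicalDensity (Torus.geometry (Fin 3)) (hsDiameter σ N) (N + 1)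
                    (localGibbsProfile (fun x => ρ (s + w N) x * Rf (σ ^ 3 * ρ (s + w N) x)) (u (s + w N)) (θ (s + w N)))
                        (lambertFlow (Torus.geometry (Fin 3)) (hsDiameter σ N) q.2 q.1 (w N))))
                    ∂(((((localGibbsLaw σ a₀ u₀ θ₀ N (Φ N)).prod (lambertNoise (Fin 3))).map
                      (fun p => lambertFlow (Torus.geometry (Fin 3)) (hsDiameter σ N) p.2 p.1 s))).prod (lambertNoise (Fin 3))) ≤
                  A * w N * Hent σ a₀ θ₀ u₀ Rf ρ θ u N (Φ N) s + w N * ((N : ℝ) + 1) * ε) ∧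
                (∀ s : ℝ, 0 ≤ s → s ≤ t → t ≤ s + w N →
                  ∫ q, (Real.log (canonicalDensity (Torus.geometry (Fin 3)) (hsDiameter σ N) (N + 1)
                    (localGibbsProfile (fun x => ρ s x * Rf (σ ^ 3 * ρ s x)) (u s) (θ s)) q.1) -
                      Real.log (canonicalDensity (Torus.geometry (Fin 3)) (hsDiameter σ N) (N + 1)
                    (localGibbsProfile (fun x => ρ t x * Rf (σ ^ 3 * ρ t x)) (u t) (θ t))
                        (lambertFlow (Torus.geometry (Fin 3)) (hsDiameter σ N) q.2 q.1 (t - s))))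
                    ∂(((((localGibbsLaw σ a₀ u₀ θ₀ N (Φ N)).prod (lambertNoise (Fin 3))).map
                      (fun p => lambertFlow (Torus.geometry (Fin 3)) (hsDiameter σ N) p.2 p.1 s))).prod (lambertNoise (Fin 3))) ≤ ((N : ℝ) + 1) * ε)

/-- **WINDOW STEP** — `H_N(s + w) ≤ (1 + A w) H_N(s) + w (N+1) ε` over full windows and `H_N(t) ≤ H_N(s) + (N+1) ε` on the last partial one (BOUND through the one-window ledger p122335). -/
def WindowStepLambda : Prop :=
  ∀ (r : ℝ) (Rf : ℝ → ℝ), 0 < r →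
      (∀ x ∈ Set.Ioo (-r) r, 0 < Rf x ∧ Rf x * (∑' j : ℕ, bE j / (j.factorial : ℝ) * (x * Rf x) ^ j) = 1) →
      (∀ x ∈ Set.Icc 0 r, 1 ≤ Rf x ∧ Rf x ≤ 2) → ContinuousOn Rf (Set.Icc 0 r) →
      (∀ x ∈ Set.Ioo (-r) r, ∀ R ∈ Set.Icc (1 / 2 : ℝ) 2,
        R * (∑' j : ℕ, bE j / (j.factorial : ℝ) * (x * R) ^ j) = 1 → R = Rf x) →
    ∀ (a₀ θ₀ : T3 → ℝ) (u₀ : T3 → V3), Continuous a₀ → Continuous θ₀ → Continuous u₀ →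
      (∀ x, 0 < a₀ x) → (∀ x, 0 < θ₀ x) →
      ∃ σ₀ : ℝ, 0 < σ₀ ∧ ∀ σ : ℝ, 0 < σ → σ < σ₀ →
        ∀ (T : ℝ) (ρ θ : ℝ → T3 → ℝ) (u : ℝ → T3 → V3), IsHardSphereEulerSolution σ T ρ u θ →
          ∀ Φ : (N : ℕ) → HardSphereFlow (Torus.geometry (Fin 3)) (hsDiameter σ N) (N + 1),
            TendstoHydroFieldsAt (fun N => localGibbsLaw σ a₀ u₀ θ₀ N (Φ N)) Φ ρ u θ 0 →
            ∀ t ∈ Set.Ioo 0 T,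
              ∃ A : ℝ, 0 ≤ A ∧ ∀ ε : ℝ, 0 < ε → ∃ w : ℕ → ℝ, (∀ N, 0 < w N) ∧ ∃ N₀ : ℕ, ∀ N : ℕ, N₀ ≤ N →
                (∀ s : ℝ, 0 ≤ s → s + w N ≤ t →
                  Hent σ a₀ θ₀ u₀ Rf ρ θ u N (Φ N) (s + w N) ≤
                    (1 + A * w N) * Hent σ a₀ θ₀ u₀ Rf ρ θ u N (Φ N) s + w N * ((N : ℝ) + 1) * ε) ∧
                (∀ s : ℝ, 0 ≤ s → s ≤ t → t ≤ s + w N →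
                  Hent σ a₀ θ₀ u₀ Rf ρ θ u N (Φ N) t ≤ Hent σ a₀ θ₀ u₀ Rf ρ θ u N (Φ N) s + ((N : ℝ) + 1) * ε)

/-- **GRONWALL along the explicit reference** — `KL(law Λ_t ‖ localGibbsLaw σ (ρ_t Rf(σ³ρ_t)) u_t θ_t)/(N+1) → 0` for `t ∈ (0,T)` in the Rf-dock's frame: verbatim the first hypothesis of the landed `…LambertianEulerDockRf.stub_dockLambdaRf` (p120849) without its dilute-self-consistency premise. -/
def GronwallRfLambda : Prop :=
  ∀ (r : ℝ) (Rf : ℝ → ℝ), 0 < r →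
      (∀ x ∈ Set.Ioo (-r) r, 0 < Rf x ∧ Rf x * (∑' j : ℕ, bE j / (j.factorial : ℝ) * (x * Rf x) ^ j) = 1) →
      (∀ x ∈ Set.Icc 0 r, 1 ≤ Rf x ∧ Rf x ≤ 2) → ContinuousOn Rf (Set.Icc 0 r) →
      (∀ x ∈ Set.Ioo (-r) r, ∀ R ∈ Set.Icc (1 / 2 : ℝ) 2,
        R * (∑' j : ℕ, bE j / (j.factorial : ℝ) * (x * R) ^ j) = 1 → R = Rf x) →
    ∀ (a₀ θ₀ : T3 → ℝ) (u₀ : T3 → V3), Continuous a₀ → Continuous θ₀ → Continuous u₀ →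
      (∀ x, 0 < a₀ x) → (∀ x, 0 < θ₀ x) →
      ∃ σ₀ : ℝ, 0 < σ₀ ∧ ∀ σ : ℝ, 0 < σ → σ < σ₀ →
        ∀ (T : ℝ) (ρ θ : ℝ → T3 → ℝ) (u : ℝ → T3 → V3), IsHardSphereEulerSolution σ T ρ u θ →
          ∀ Φ : (N : ℕ) → HardSphereFlow (Torus.geometry (Fin 3)) (hsDiameter σ N) (N + 1),
            TendstoHydroFieldsAt (fun N => localGibbsLaw σ a₀ u₀ θ₀ N (Φ N)) Φ ρ u θ 0 →
            ∀ t ∈ Set.Ioo 0 T,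
              ∀ (hac : Continuous fun x => ρ t x * Rf (σ ^ 3 * ρ t x))
                (hap : ∀ x, 0 < ρ t x * Rf (σ ^ 3 * ρ t x)),
                (∀ x, ρ t x ≤ ρ t x * Rf (σ ^ 3 * ρ t x) ∧ ρ t x * Rf (σ ^ 3 * ρ t x) ≤ 2 * ρ t x) →
                SmallDensity (profileOf (fun x => ρ t x * Rf (σ ^ 3 * ρ t x)) hac hap) σ →
                rhoLim (profileOf (fun x => ρ t x * Rf (σ ^ 3 * ρ t x)) hac hap) σ = ρ t →
                Tendsto (fun N : ℕ => klDiv (((localGibbsLaw σ a₀ u₀ θ₀ N (Φ N)).prod (lambertNoise (Fin 3))).map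
                        (fun p => lambertFlow (Torus.geometry (Fin 3)) (hsDiameter σ N) p.2 p.1 t))
                  (localGibbsLaw σ (fun x => ρ t x * Rf (σ ^ 3 * ρ t x)) (u t) (θ t) N (Φ N)) / ((N : ℝ≥0∞) + 1)) atTop (𝓝 0)

/-! ## §3 Pure-ℝ bookkeeping of the in-window bootstrap (registered sub-goals) -/

/-- GLUE (proved, v30; registered sub-goal of stmt-11854). Pure bookkeeping of the in-window bootstrap, full window:
`P ≤ C w (H + C w C₀ n + 2ε₁ n) + 2ε₁ n`, `C²C₀w ≤ ε/2`, `2ε₁(Cw+1) = wε/2` give `P ≤ 2Cw H + w n ε`. [folklore] -/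
theorem estimate_arith_full : ∀ {P H C C₀ w ε ε₁ n : ℝ}, 0 ≤ C → 0 < w → 0 < n → 0 ≤ H → P ≤ C * w * (H + C * w * (C₀ * n) + 2 * ε₁ * n) + 2 * ε₁ * n → C ^ 2 * C₀ * w ≤ ε / 2 → 2 * ε₁ * (C * w + 1) = w * ε / 2 → P ≤ 2 * C * w * H + w * n * ε := by
  intro P H C C₀ w ε ε₁ n hC hw hn hH hfin hk1 hk2
  have hA : C * w * H ≤ 2 * C * w * H := by nlinarith [mul_nonneg (mul_nonneg hC hw.le) hH]
  have hB : C * w * (C * w * (C₀ * n)) ≤ w * n * (ε / 2) := by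
    have : C * w * (C * w * (C₀ * n)) = w * n * (C ^ 2 * C₀ * w) := by ring
    rw [this]
    exact mul_le_mul_of_nonneg_left hk1 (by positivity)
  have hCε : C * w * (2 * ε₁ * n) + 2 * ε₁ * n = w * n * (ε / 2) := by
    have : C * w * (2 * ε₁ * n) + 2 * ε₁ * n = (2 * ε₁ * (C * w + 1)) * n := by ring
    rw [this, hk2]; ring
  have hdist : C * w * (H + C * w * (C₀ * n) + 2 * ε₁ * n) =
      C * w * H + C * w * (C * w * (C₀ * n)) + C * w * (2 * ε₁ * n) := by ring
  linarith

/-- GLUE (proved, v30; registered sub-goal of stmt-11854). Pure bookkeeping, last partial window: `P ≤ C d C₀ n + 2ε₁ n`, `d ≤ w ≤ 1`,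
`C C₀ w ≤ ε/2`, `2ε₁(Cw+1) = wε/2` give `P ≤ n ε`. [folklore] -/
theorem estimate_arith_partial : ∀ {P C C₀ w ε ε₁ n d : ℝ}, 0 ≤ C → 0 ≤ C₀ → 0 < w → w ≤ 1 → 0 < n → 0 < ε → 0 < ε₁ → d ≤ w → P ≤ C * d * (C₀ * n) + 2 * ε₁ * n → C * C₀ * w ≤ ε / 2 → 2 * ε₁ * (C * w + 1) = w * ε / 2 → P ≤ n * ε := by
  intro P C C₀ w ε ε₁ n d hC hC₀ hw hw1 hn hε hε₁ hd hp hk1 hk2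
  have hcr : C * d * (C₀ * n) ≤ C * w * (C₀ * n) := by
    have h0 : 0 ≤ C * (C₀ * n) := by positivity
    nlinarith
  have hB : C * w * (C₀ * n) ≤ n * (ε / 2) := by
    have : C * w * (C₀ * n) = n * (C * C₀ * w) := by ring
    rw [this]
    exact mul_le_mul_of_nonneg_left hk1 hn.le
  have hE2 : 2 * ε₁ ≤ ε / 2 := by
    have h2 : 2 * ε₁ * (C * w + 1) = 2 * ε₁ + 2 * ε₁ * (C * w) := by ring
    have h3 : 0 ≤ 2 * ε₁ * (C * w) := by
      have := mul_nonneg hC hw.le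
      positivity
    have h4 : w * ε ≤ 1 * ε := mul_le_mul_of_nonneg_right hw1 hε.le
    linarith
  have hE3 : 2 * ε₁ * n ≤ ε / 2 * n := mul_le_mul_of_nonneg_right hE2 hn.le
  have hcomm : ε / 2 * n + n * (ε / 2) = n * ε := by ring
  linarith

end Summit.AtomisticToContinuum.HydrodynamicLimit.Theorems.LambertianContactSwapLambertianEulerHearts
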